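import Literature.AlgebraicGeometry.GroupSchemes.CartierDualAlgBaseChange
import Literature.AlgebraicGeometry.GroupSchemes.CartierDualBidual
import HarnessLib

/-!
# The Cartier dual commutes with base change: `(G^D)_{R′} ≅ (G_{R′})^D` as group schemes (Tate 1997 §(3.8) «`(A_B)′ = A′_B`»)

Layer `Literature/AlgebraicGeometry/GroupSchemes`, namespace `Literature.AlgebraicGeometry.GroupSchemes.AffineGroupScheme` (continues ★
`CartierDualAlgBaseChange` — `exists_bialgEquiv_tensor_dualAlg : R′ ⊗ Γ(G)^* ≃ₐc Γ(G_{R′})^*` —, ★ `AffineGroupSchemeBaseChangeHopf` p845509 —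
`algBaseChangeBialgEquiv` —, ★ `CartierDualBidual` p845413 — `algCartierDualBialgEquiv : Γ(G^D) ≃ₐc Γ(G)^*` —, ★ `AffineGroupSchemeBialgHom` p845266 —
`isMonHom_specOverMapOfAlgHom` — and ★ `AffineGroupSchemeIsoSpec` p845351 — `isMonHom_isoSpecOver_hom`).  DEFINITIONS (`specOverIsoOfBialgEquiv`,
`tensorAlgCartierDualBialgEquiv`) + theorems; no instance, no notation, no named fact, no `sorry`.  Cell `hodgecm-mathlib` (D-0151), programme P6 «MOD»,
HEART organ (g1) rider (b) step 3b (last) of B-p04 (g37): base change of the Cartier dual (ST-0 «`(·)^⊥` ∕ `(·)^D` commute with base change along the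
three levels»; LEAD F0P6-plan (g0) 16:15:19Z rider order).  Count-neutral Mathlib-side capital: HC_CM is proved only modulo the 7 printed citations until
rung 0 closes; nothing here bears on it.

THE PRINT ([Tate1997FiniteFlatGroupSchemes] §(3.8) p. 145: «`(A_B)′ = A′_B`, so `(G_B)^D = (G^D)_B`»).  For a finite free commutative affine group scheme `G`
over `R` and an `R`-algebra `R′`, with `X_{R′} := (Over.pullback (Spec R′ → Spec R)).obj X` carrying Mathlib's transported group object (scoped instance
`CategoryTheory.Obj`):

* §1 `Spec` of a bialgebra EQUIVALENCE is an ISOMORPHISM of group schemes: **`specOverIsoOfBialgEquiv e : specOver R H₂ ≅ specOver R H₁`** (`e : H₁ ≃ₐc[R] H₂`),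
  `isMonHom_specOverIsoOfBialgEquiv_hom` (★ `isMonHom_specOverMapOfAlgHom`);
* §2 **`tensorAlgCartierDualBialgEquiv R′ G : R′ ⊗[R] Alg (cartierDual G) ≃ₐc[R′] R′ ⊗[R] DualAlg G`** (`R′ ⊗ –` applied to ★ `algCartierDualBialgEquiv`;
  Mathlib `Bialgebra.TensorProduct.map`, bijective with inverse `R′ ⊗ e⁻¹`);
* §3 HEAD **`exists_iso_cartierDual_baseChange`**: `∃ φ : (cartierDual G)_{R′} ≅ cartierDual (G_{R′}), IsMonHom φ.hom` — the composite
  `(G^D)_{R′} ≅ Spec Γ((G^D)_{R′})` (★ `isoSpecOver`, a homomorphism by ★ `isMonHom_isoSpecOver_hom`) `≅ Spec (Γ(G_{R′})^*) = (G_{R′})^D` (`Spec` of the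
  bialgebra equivalence `Γ((G^D)_{R′}) ≃ₐc R′ ⊗ Γ(G^D) ≃ₐc R′ ⊗ Γ(G)^* ≃ₐc Γ(G_{R′})^*`, §§1–2 + ★ `exists_bialgEquiv_tensor_dualAlg`); `∃`-form because ★
  CD2-bcc is.

## References
* [Tate1997FiniteFlatGroupSchemes] J. Tate, *Finite flat group schemes*, in: Modular Forms and Fermat's Last Theorem (1997), §(3.8) p. 145.
* [GortzWedhorn2023] U. Görtz, T. Wedhorn, *Algebraic Geometry II* (2023), §(27.2) (pp. 606–607).
-/

set_option autoImplicit false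

-- Mathlib's `Over`/`Scheme` APIs are stated across semireducible wrappers (as in the ★ `GroupSchemes/*` files).
set_option backward.isDefEq.respectTransparency false

universe u

open CategoryTheory CategoryTheory.Limits AlgebraicGeometry MonoidalCategory CartesianMonoidalCategory TensorProduct WithConv

noncomputable section

namespace Literature.AlgebraicGeometry.GroupSchemes

namespace AffineGroupScheme

open scoped MonObj CategoryTheory.Obj

open Literature.AlgebraicGeometry.Motives Literature.NumberTheory.DiophantineGeometry Literature.RingTheory.HopfAlgebra

/-! ## §1 `Spec` of a bialgebra equivalence is an isomorphism of group schemes -/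

section SpecIso

variable {R : Type u} [CommRing R] {H₁ H₂ H₃ : Type u} [CommRing H₁] [Algebra R H₁] [CommRing H₂] [Algebra R H₂] [CommRing H₃] [Algebra R H₃]

/-- `Spec` of a composite of `R`-algebra maps (over a commutative RING; cf. ★ `specOverMapOfAlgHom_comp` over a field).
[cite: GortzWedhorn2023, §(27.2) (p. 606)] -/
private theorem specOverMapOfAlgHom_comp' (ψ₁ : H₁ →ₐ[R] H₂) (ψ₂ : H₂ →ₐ[R] H₃) :
    AlgPoints.specOverMapOfAlgHom ψ₂ ≫ AlgPoints.specOverMapOfAlgHom ψ₁ = AlgPoints.specOverMapOfAlgHom (ψ₂.comp ψ₁) := by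
  apply Over.OverMorphism.ext
  rw [Over.comp_left, AlgPoints.specOverMapOfAlgHom_left, AlgPoints.specOverMapOfAlgHom_left, AlgPoints.specOverMapOfAlgHom_left]
  exact (Spec.map_comp (CommRingCat.ofHom ψ₁.toRingHom) (CommRingCat.ofHom ψ₂.toRingHom)).symm

/-- `Spec` of the identity (over a commutative RING). [cite: GortzWedhorn2023, §(27.2) (p. 606)] -/
private theorem specOverMapOfAlgHom_id' : AlgPoints.specOverMapOfAlgHom (AlgHom.id R H₁) = 𝟙 (specOver R H₁) := by
  apply Over.OverMorphism.ext
  rw [AlgPoints.specOverMapOfAlgHom_left, Over.id_left]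
  exact Spec.map_id _

end SpecIso

section SpecIsoHopf

variable {R : Type u} [CommRing R] {H₁ H₂ : Type u} [CommRing H₁] [HopfAlgebra R H₁] [CommRing H₂] [HopfAlgebra R H₂] (e : H₁ ≃ₐc[R] H₂)

/-- **`Spec` of a bialgebra EQUIVALENCE `e : H₁ ≃ H₂` as an ISOMORPHISM `Spec H₂ ≅ Spec H₁` over `R`** (inverse `Spec e⁻¹`).
[cite: GortzWedhorn2023, §(27.2) (27.2.1) and Definition 27.6 (pp. 606–607)] -/
def specOverIsoOfBialgEquiv : specOver R H₂ ≅ specOver R H₁ where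
  hom := AlgPoints.specOverMapOfAlgHom ((e : H₁ →ₐc[R] H₂) : H₁ →ₐ[R] H₂)
  inv := AlgPoints.specOverMapOfAlgHom ((e.symm : H₂ →ₐc[R] H₁) : H₂ →ₐ[R] H₁)
  hom_inv_id := by
    rw [specOverMapOfAlgHom_comp', ← specOverMapOfAlgHom_id']
    congr 1
    exact AlgHom.ext fun b => e.apply_symm_apply b
  inv_hom_id := by
    rw [specOverMapOfAlgHom_comp', ← specOverMapOfAlgHom_id']
    congr 1
    exact AlgHom.ext fun a => e.symm_apply_apply a

/-- Its morphism is `Spec e`. [cite: GortzWedhorn2023, §(27.2) (p. 606)] -/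
theorem specOverIsoOfBialgEquiv_hom :
    (specOverIsoOfBialgEquiv e).hom = AlgPoints.specOverMapOfAlgHom ((e : H₁ →ₐc[R] H₂) : H₁ →ₐ[R] H₂) := rfl

/-- **`Spec e` is a homomorphism of group schemes** for ★ `grpObjOfHopfAlgebra` on both sides (★ `isMonHom_specOverMapOfAlgHom`).
[cite: GortzWedhorn2023, §(27.2) (27.2.1) and Definition 27.6 (pp. 606–607)] -/
theorem isMonHom_specOverIsoOfBialgEquiv_hom :
    letI := grpObjOfHopfAlgebra R H₁
    letI := grpObjOfHopfAlgebra R H₂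
    IsMonHom (specOverIsoOfBialgEquiv e).hom :=
  isMonHom_specOverMapOfAlgHom R (e : H₁ →ₐc[R] H₂)

end SpecIsoHopf

/-! ## §2 `R′ ⊗ Γ(G^D) ≃ₐc R′ ⊗ Γ(G)^*` -/

section Tensor

variable {R : Type u} [CommRing R] (R' : Type u) [CommRing R'] [Algebra R R'] (G : SchemeOver R) [GrpObj G] [IsCommMonObj G] [IsAffine G.left]
  [Module.Free R (Alg G)] [Module.Finite R (Alg G)]

/-- `(R′ ⊗ e⁻¹) ∘ (R′ ⊗ e) = id` and `(R′ ⊗ e) ∘ (R′ ⊗ e⁻¹) = id` on elements, for `e := algCartierDualBialgEquiv G`.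
[cite: Tate1997FiniteFlatGroupSchemes, §(3.8) p. 145] -/
theorem tensor_map_algCartierDualBialgEquiv_symm_apply (x : R' ⊗[R] Alg (cartierDual G)) :
    Bialgebra.TensorProduct.map (BialgHom.id R' R') ((algCartierDualBialgEquiv G).symm : DualAlg G →ₐc[R] Alg (cartierDual G))
        (Bialgebra.TensorProduct.map (BialgHom.id R' R') (algCartierDualBialgEquiv G : Alg (cartierDual G) →ₐc[R] DualAlg G) x) = x := by
  induction x using TensorProduct.induction_on with
  | zero => simp
  | tmul r a =>
      rw [Bialgebra.TensorProduct.map_tmul, Bialgebra.TensorProduct.map_tmul]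
      change r ⊗ₜ (algCartierDualBialgEquiv G).symm (algCartierDualBialgEquiv G a) = r ⊗ₜ a
      rw [BialgEquiv.symm_apply_apply]
  | add x y hx hy => rw [map_add, map_add, hx, hy]

/-- The other composite. [cite: Tate1997FiniteFlatGroupSchemes, §(3.8) p. 145] -/
theorem tensor_map_algCartierDualBialgEquiv_apply_symm (y : R' ⊗[R] DualAlg G) :
    Bialgebra.TensorProduct.map (BialgHom.id R' R') (algCartierDualBialgEquiv G : Alg (cartierDual G) →ₐc[R] DualAlg G)
        (Bialgebra.TensorProduct.map (BialgHom.id R' R') ((algCartierDualBialgEquiv G).symm : DualAlg G →ₐc[R] Alg (cartierDual G)) y) = y := by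
  induction y using TensorProduct.induction_on with
  | zero => simp
  | tmul r f =>
      rw [Bialgebra.TensorProduct.map_tmul, Bialgebra.TensorProduct.map_tmul]
      change r ⊗ₜ (algCartierDualBialgEquiv G) ((algCartierDualBialgEquiv G).symm f) = r ⊗ₜ f
      rw [BialgEquiv.apply_symm_apply]
  | add x y hx hy => rw [map_add, map_add, hx, hy]

/-- **`R′ ⊗_R Γ(G^D, 𝒪) ≃ₐc[R′] R′ ⊗_R Γ(G, 𝒪)^*`**: `R′ ⊗ –` applied to ★ `algCartierDualBialgEquiv` (Mathlib `Bialgebra.TensorProduct.map` with the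
identity of `R′`; bijective with inverse `R′ ⊗ e⁻¹`). [cite: Tate1997FiniteFlatGroupSchemes, §(3.8) p. 145] -/
def tensorAlgCartierDualBialgEquiv : R' ⊗[R] Alg (cartierDual G) ≃ₐc[R'] R' ⊗[R] DualAlg G :=
  BialgEquiv.ofBijective
    (Bialgebra.TensorProduct.map (BialgHom.id R' R') (algCartierDualBialgEquiv G : Alg (cartierDual G) →ₐc[R] DualAlg G))
    (Function.bijective_iff_has_inverse.mpr
      ⟨Bialgebra.TensorProduct.map (BialgHom.id R' R') ((algCartierDualBialgEquiv G).symm : DualAlg G →ₐc[R] Alg (cartierDual G)),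
        tensor_map_algCartierDualBialgEquiv_symm_apply R' G, tensor_map_algCartierDualBialgEquiv_apply_symm R' G⟩)

/-- `tensorAlgCartierDualBialgEquiv (r ⊗ a) = r ⊗ e a`. [cite: Tate1997FiniteFlatGroupSchemes, §(3.8) p. 145] -/
theorem tensorAlgCartierDualBialgEquiv_tmul (r : R') (a : Alg (cartierDual G)) :
    tensorAlgCartierDualBialgEquiv R' G (r ⊗ₜ a) = r ⊗ₜ algCartierDualBialgEquiv G a := rfl

end Tensor

/-! ## §3 `(G^D)_{R′} ≅ (G_{R′})^D` -/

section BaseChange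

variable {R : Type u} [CommRing R] (R' : Type u) [CommRing R'] [Algebra R R'] (G : SchemeOver R) [GrpObj G] [IsCommMonObj G] [IsAffine G.left]
  [Module.Free R (Alg G)] [Module.Finite R (Alg G)]
  [IsAffine ((Over.pullback (Spec.map (CommRingCat.ofHom (algebraMap R R')))).obj G).left]
  [IsCommMonObj ((Over.pullback (Spec.map (CommRingCat.ofHom (algebraMap R R')))).obj G)]
  [Module.Free R' (Alg ((Over.pullback (Spec.map (CommRingCat.ofHom (algebraMap R R')))).obj G))]
  [Module.Finite R' (Alg ((Over.pullback (Spec.map (CommRingCat.ofHom (algebraMap R R')))).obj G))]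
  [IsAffine ((Over.pullback (Spec.map (CommRingCat.ofHom (algebraMap R R')))).obj (cartierDual G)).left]

set_option maxHeartbeats 400000 in
-- unifying the transported group object of `(G^D)_{R′}` and the displayed target `cartierDual (G_{R′})` costs ≈ 250k heartbeats
/-- **`(G^D)_{R′} ≅ (G_{R′})^D` from ANY bialgebra equivalence `Φ : Γ((G^D)_{R′}) ≃ₐc Γ(G_{R′})^*`**: `(G^D)_{R′} ≅ Spec Γ((G^D)_{R′})`
(★ `isoSpecOver`, a homomorphism for ★ `grpObjOfHopfAlgebra`, ★ `isMonHom_isoSpecOver_hom`) followed by `Spec Φ⁻¹` (§1).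
[cite: Tate1997FiniteFlatGroupSchemes, §(3.8) p. 145] -/
theorem exists_iso_cartierDual_baseChange_of_bialgEquiv
    (Φ : Alg ((Over.pullback (Spec.map (CommRingCat.ofHom (algebraMap R R')))).obj (cartierDual G)) ≃ₐc[R']
      DualAlg ((Over.pullback (Spec.map (CommRingCat.ofHom (algebraMap R R')))).obj G)) :
    ∃ φ : (Over.pullback (Spec.map (CommRingCat.ofHom (algebraMap R R')))).obj (cartierDual G) ≅
        cartierDual ((Over.pullback (Spec.map (CommRingCat.ofHom (algebraMap R R')))).obj G),
      IsMonHom φ.hom := by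
  -- `Spec Φ⁻¹ : Spec Γ((G^D)_{R′}) ≅ (G_{R′})^D`, displayed with target `cartierDual (G_{R′})`
  let σ : specOver R' (Alg ((Over.pullback (Spec.map (CommRingCat.ofHom (algebraMap R R')))).obj (cartierDual G))) ≅
      cartierDual ((Over.pullback (Spec.map (CommRingCat.ofHom (algebraMap R R')))).obj G) :=
    specOverIsoOfBialgEquiv Φ.symm
  letI : GrpObj (specOver R' (Alg ((Over.pullback (Spec.map (CommRingCat.ofHom (algebraMap R R')))).obj (cartierDual G)))) :=
    grpObjOfHopfAlgebra R' _
  haveI h1 : IsMonHom (isoSpecOver ((Over.pullback (Spec.map (CommRingCat.ofHom (algebraMap R R')))).obj (cartierDual G))).hom :=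
    isMonHom_isoSpecOver_hom _
  haveI h2 : IsMonHom σ.hom := isMonHom_specOverIsoOfBialgEquiv_hom Φ.symm
  refine ⟨isoSpecOver _ ≪≫ σ, ?_⟩
  rw [Iso.trans_hom]
  infer_instance

set_option maxHeartbeats 400000 in
-- the three-step bialgebra chain below elaborates several nested base-change instances (≈ 250k heartbeats)
/-- **HEAD — the Cartier dual commutes with base change**: an isomorphism of GROUP schemes over `R′`
`(cartierDual G)_{R′} ≅ cartierDual (G_{R′})` (`X_{R′} := (Over.pullback (Spec R′ → Spec R)).obj X` with Mathlib's transported group structure;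
`G_{R′}` finite free commutative through the instance-form binders, dischargeable by ★ `free_∕finite_alg_baseChange`, Mathlib `Functor.isCommMonObj_obj`
and ★ `isAffine_pullback_obj_left`), from the bialgebra equivalence `Γ((G^D)_{R′}) ≃ₐc R′ ⊗ Γ(G^D) ≃ₐc R′ ⊗ Γ(G)^* ≃ₐc Γ(G_{R′})^*`
(★ `algBaseChangeBialgEquiv`, `tensorAlgCartierDualBialgEquiv`, ★ `exists_bialgEquiv_tensor_dualAlg`; `∃`-form because ★ CD2-bcc is).
[Tate1997FiniteFlatGroupSchemes] §(3.8): «`(G_B)^D = (G^D)_B`». [cite: Tate1997FiniteFlatGroupSchemes, §(3.8) p. 145] -/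
theorem exists_iso_cartierDual_baseChange :
    ∃ φ : (Over.pullback (Spec.map (CommRingCat.ofHom (algebraMap R R')))).obj (cartierDual G) ≅
        cartierDual ((Over.pullback (Spec.map (CommRingCat.ofHom (algebraMap R R')))).obj G),
      IsMonHom φ.hom := by
  letI := FiniteDual.bialgebra R' (R' ⊗[R] Alg G)
  obtain ⟨Ψ, -⟩ := exists_bialgEquiv_tensor_dualAlg R' G
  exact exists_iso_cartierDual_baseChange_of_bialgEquiv R' G
    ((algBaseChangeBialgEquiv R' (cartierDual G)).trans ((tensorAlgCartierDualBialgEquiv R' G).trans Ψ))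

end BaseChange

end AffineGroupScheme

end Literature.AlgebraicGeometry.GroupSchemes

end
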